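import Literature.Computability.AlgebraicComplexity.BorderHittingSetsExist
import Literature.Computability.AlgebraicComplexity.UniversalCircuitInt
import Literature.Computability.AlgebraicComplexity.DDS21BorderDepthThree
import Literature.Computability.AlgebraicComplexity.ApproxComplexityProjections
import Literature.Computability.AlgebraicComplexity.BorderComplexityZariski
import HarnessLib

/-!
# Hitting sets of polynomial size EXIST for the border of size-`s` degree-`d` circuits
# (Heintz–Schnorr 1980, Thm. 4.4 — existence half, for `\overline{VP}`-slices)

Topic: `Literature/Computability/AlgebraicComplexity` (theorem-only; no named facts).

**Theorem (`BorderHittingSets.exists_hittingSet_border_smallCircuits`).** For every infinite field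
`K` and all `n, s, d` there is a set `H ⊆ K^n` with `|H| ≤ 9376·(n+d+s+2)^26 + 1` such that every
non-zero `f ∈ K[x_1, …, x_n]` which is APPROXIMATED (`MS2021.IsEpsApprox`: `g = f + ε·Q`,
`Q ∈ K[ε][x]`) by some `g ∈ K(ε)[x_1, …, x_n]` of total degree `≤ d` and circuit size
`complexity g ≤ s` over `K(ε)` satisfies `f(a) ≠ 0` for some `a ∈ H`; equivalently
(`isHittingSetFor_border_smallCircuits`) `H` is a hitting set for
`DDS2021.border {g | deg g ≤ d ∧ complexity g ≤ s}`, the `ε`-border of the `VP`-slice.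

This is the existence half of [HS80, Thm. 4.4] for the Zariski closure of the class of easy
polynomials ("there exist hitting sets `H ⊂ [u]^n`, `u = 2s(d+1)²`, `#H = 6(s+1+n)²` for
`W(n,s,d)`"; CKRST 2020 arXiv v4 Thm. 3.3 "Rewording of [HS80a, Theorem 4.4]"; Bürgisser 2024,
§6: "The proof in [HS82] relies on bounding the dimension and degree of the affine variety
`𝒞̄(n,d,s)` … This even provides hitting set generators for `𝒞̄(n,d,s)`"), obtained by feeding
the INTEGER universal circuit of Raz / Forbes–Shpilka–Volk
(`RazUniversal.exists_universalCircuit_int`: one `U ∈ ℤ[x, y]`, `p ≤ 9376(n+d+s+2)^26` labels,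
universal over EVERY commutative ring — in particular over `K(ε)`) as the generic member into
`BorderHittingSets.exists_hittingSet_border` (prime avoidance on the cone over the closure; no
degree theory). NOT recorded: the printed coordinate bound `[u]^n` and size `6(s+1+n)²` (we get
`p + 1` points with unbounded coordinates); the tree's `HittingSets.exists_hittingSet`
(`HittingSetsExist.lean`) gives grid points for the class ITSELF but not for its border.
Honest framing: a 1980 existence theorem; nothing explicit; no bearing on VP versus VNP.

## The Zariski closure `W(n,s,d)` and the closure complexities (second part)

[HS80, Thm. 4.4] is printed for `W(n,s,d)`, the ZARISKI CLOSURE in coefficient space of the set of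
polynomials of degree `≤ d` computable with `≤ s` (nonscalar) operations. With the engine's Zariski
form (`BorderHittingSets.exists_hittingSet_zariskiClosure`) the file also proves, in the tree's four
closure currencies:

* `coeffVec_mem_zariskiClosure_of_mem_borderClass`, `exists_hittingSet_borderClass` (for ANY class
  given by generic members `𝒢_j ∈ K[y_1, …, y_r][x]`, `K` infinite): the `ε`-closure over the
  Laurent series field — Andrews–Forbes 2022's `𝒞̄ = borderClass K 𝒞_{K((ε))}` (Def. 2.1 / §2.1:
  `h = f + O(ε)` coefficientwise for a member `h` over `K((ε))`) — lies in the Zariski closure of the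
  coefficient vectors of the `K`-members (Bürgisser 2004 Thm. 2.2, the "easy inclusion", by generic
  constants: a coefficient relation valid on all `K`-members pulls back to `0 ∈ K[y]` and so holds
  for members over every `K`-algebra, `aeval_coeff_member_eq_zero`; with coefficients in `K` it
  passes to the constant terms), hence `𝒞̄` is hit by the `r + 1` points of the Zariski form; and
  `isHittingSetFor_borderClass_smallCircuits`: `|H| ≤ 9376(n+d+s+2)^26 + 1` points hit
  `borderClass K {g ∈ K((ε))[x] | deg g ≤ d, complexity g ≤ s}` (which contains the `K(ε)`-border
  of the first part).
* `exists_hittingSet_zariskiClosure_smallCircuits` / `isHittingSetFor_zariskiClosure_smallCircuits`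
  — over any infinite field `K`: `|H| ≤ 9376(n+d+s+2)^26 + 1` points hit every non-zero `f` with
  `coeffVec f ∈ zariskiClosure (coeffVec '' {g : K[x] | deg g ≤ d ∧ complexity g ≤ s})` — the
  printed `W(n,s,d)` verbatim (with the tree's fan-in-two `complexity`, constants free, in place of
  the nonscalar cost; sizes `6(s+1+n)²` in `[u]^n` in print, `p + 1` unbounded points here).
* `exists_hittingSet_approxComplexity_le` — over `ℂ`, for BLMW 2011 Def. 9.3.1's
  `approxComplexity` (`\underline{L}(f) ≤ s`: `coeff f` in the Zariski closure of `{g | L(g) ≤ s}`,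
  approximants of UNBOUNDED degree): `|H| ≤ 9376(n+d+s'+2)^26 + 1` with `s' = (d+2)²s + (d+1)`
  hits every non-zero `f` with `deg f ≤ d` and `\underline{L}(f) ≤ s`; the factor `(d+2)²` is the
  truncation cost (BCS 1997 Lemma (21.25) = the tree's `complexity_sum_homogeneousComponent_le`;
  truncation to degree `≤ d` is Zariski-continuous, `coeffVec_mem_zariskiClosure_of_rowFinite` /
  `rowFinite_comp_truncation` of `ApproxComplexityProjections.lean`, here over any field as
  `coeffVec_mem_zariskiClosure_truncated_of_mem`).
* `exists_hittingSet_borderComplexity_le` — over any infinite field, for Bürgisser 2004 Def. 2.1 /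
  CKRST v4 Def. 1.12's `borderComplexity` (`L̲_ε(f) ≤ s`: a size-`s` circuit over `K((ε))` computes
  `f + O(ε)`), same bound `s'`, via the tree's easy inclusion
  `coeffVec_mem_zariskiClosure_of_borderComplexity_le` (`BorderComplexityZariski.lean`,
  Bürgisser 2004 Thm. 2.2).

These are the "non-explicit hitting sets for `\overline{VP}`" of the PIT literature (Forbes–Shpilka
2018 §1 / Guo–Saxena–Sinhababu 2019 §1 attribute their existence to [HS80]; Bürgisser 2024 §6:
"This even provides hitting set generators for `𝒞̄(n,d,s)`"), and the closure case of CKRST v4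
Thms. 3.2–3.3, which `CKRST20EquationsFromHittingSets.lean` lists as "not in the tree". Nothing
explicit; nothing here bears on VP versus VNP, which is NOT proved.

## References

* [HeintzSchnorr1980] J. Heintz, C.-P. Schnorr, *Testing polynomials which are easy to compute*,
  STOC 1980, Thm. 4.4.
* [ChatterjeeKumarRamyaSaptharishiTengse2020] arXiv:2004.14147v4 §3.1, Thm. 3.3 (held text
  HOME/lit/pdftxt/CKRST2020 p025).
* [ForbesShpilkaVolk2018] Thm. 12 (the universal circuit); [Raz2010] Prop. 3.3.
* [DuttaDwivediSaxena2022] Def. 2.1 (the `ε`-border); [AndrewsForbes2022] Def. 2.1, §2.1 (`𝒞̄`).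
* [Burgisser2004Factors] P. Bürgisser, *The complexity of factors of multivariate polynomials*,
  Found. Comput. Math. 4 (2004), Def. 2.1, Thm. 2.2; [BurgisserEtAl2011] Def. 9.3.1
  (`\\underline{L}`); [BurgisserClausenShokrollahi1997] Lemma (21.25) (homogeneous components).
-/

noncomputable section

open MvPolynomial

namespace Literature.Computability.AlgebraicComplexity

namespace BorderHittingSets

universe u

variable {K : Type u} [Field K]

/-- **The universal circuit as a generic member.** For all `n, s, d` there are
`p ≤ 9376(n+d+s+2)^26` parameters and ONE generic member `𝒢 ∈ K[y_1..y_p][x_1..x_n]` (the integer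
universal circuit of Raz / Forbes–Shpilka–Volk, base-changed to `K` and curried) whose
specialisations over ANY field extension `L ⊇ K` contain every `g ∈ L[x]` of total degree `≤ d` and
complexity `≤ s`. [cite: ForbesShpilkaVolk2018, Thm. 12] -/
theorem exists_generic_smallCircuits (n s d : ℕ) :
    ∃ (p : ℕ) (𝒢 : Unit → MvPolynomial (Fin n) (MvPolynomial (Fin p) K)),
      p ≤ 9376 * (n + d + s + 2) ^ 26 ∧
      ∀ (L : Type u) [Field L] [Algebra K L] (g : MvPolynomial (Fin n) L),
        g.totalDegree ≤ d → complexity g ≤ s → IsMember 𝒢 L g := by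
  obtain ⟨p, U, hp, -, -, -, huniv⟩ := RazUniversal.exists_universalCircuit_int n s d
  refine ⟨p, fun _ => sumAlgEquiv K (Fin n) (Fin p) (MvPolynomial.map (Int.castRingHom K) U), hp,
    fun L _ _ g hgd hgs => ?_⟩
  obtain ⟨α, hα⟩ := huniv L g hgd hgs
  refine ⟨(), α, ?_⟩
  rw [← hα]
  -- both sides are `K`-algebra maps in `U_K`; compare them on the variables
  have hcomp : (algebraMap K L).comp (Int.castRingHom K) = Int.castRingHom L :=
    RingHom.ext_int _ _
  have hmap : MvPolynomial.map (Int.castRingHom L) U =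
      MvPolynomial.map (algebraMap K L) (MvPolynomial.map (Int.castRingHom K) U) := by
    rw [map_map, hcomp]
  rw [hmap, aeval_map_algebraMap]
  set V := MvPolynomial.map (Int.castRingHom K) U with hV
  change aeval (Sum.elim X fun j => C (α j)) V =
    (mapAlgHom (aeval α : MvPolynomial (Fin p) K →ₐ[K] L)) (sumAlgEquiv K (Fin n) (Fin p) V)
  rw [show (mapAlgHom (aeval α : MvPolynomial (Fin p) K →ₐ[K] L)) (sumAlgEquiv K (Fin n) (Fin p) V) =
      ((mapAlgHom (aeval α : MvPolynomial (Fin p) K →ₐ[K] L)).comp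
        (sumAlgEquiv K (Fin n) (Fin p)).toAlgHom) V from rfl]
  congr 1
  refine MvPolynomial.algHom_ext fun i => ?_
  rcases i with i | j
  · simp [mapAlgHom_apply]
  · simp [mapAlgHom_apply]

/-- **Heintz–Schnorr 1980, Thm. 4.4 (existence half) for the border of the `VP`-slice.** Over an
infinite field `K`, for all `n, s, d` there is `H ⊆ K^n`, `|H| ≤ 9376(n+d+s+2)^26 + 1`, hitting
every non-zero `f ∈ K[x]` approximated (`MS2021.IsEpsApprox`) by a polynomial over `K(ε)` of total
degree `≤ d` and complexity `≤ s`. Printed: "hitting sets `H ⊂ [u]^n` with `u = 2s(d+1)²`,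
`#H = 6(s+1+n)²`" for the closure `W(n,s,d)`; here `p + 1` points for the `p`-label universal
circuit, coordinates unbounded. [cite: HeintzSchnorr1980, Thm. 4.4] -/
theorem exists_hittingSet_border_smallCircuits [Infinite K] (n s d : ℕ) :
    ∃ H : Finset (Fin n → K), H.card ≤ 9376 * (n + d + s + 2) ^ 26 + 1 ∧
      ∀ f : MvPolynomial (Fin n) K, f ≠ 0 →
        (∃ g : MvPolynomial (Fin n) (RatFunc K),
          g.totalDegree ≤ d ∧ complexity g ≤ s ∧ MS2021.IsEpsApprox f g) →
        ∃ x ∈ H, eval x f ≠ 0 := by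
  obtain ⟨p, 𝒢, hp, hmem⟩ := exists_generic_smallCircuits (K := K) n s d
  obtain ⟨H, hcard, hH⟩ := exists_hittingSet_border 𝒢
  refine ⟨H, ?_, fun f hf0 hf => ?_⟩
  · rw [Fintype.card_fin] at hcard
    omega
  · obtain ⟨g, hgd, hgs, hfg⟩ := hf
    exact hH f hf0 ⟨g, hmem (RatFunc K) g hgd hgs, hfg⟩

/-- The same as a hitting set for the `ε`-border (`DDS2021.border`) of the `VP`-slice
`{g ∈ K(ε)[x] : deg g ≤ d, L(g) ≤ s}`. [cite: HeintzSchnorr1980, Thm. 4.4] -/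
theorem isHittingSetFor_border_smallCircuits [Infinite K] (n s d : ℕ) :
    ∃ H : Finset (Fin n → K), H.card ≤ 9376 * (n + d + s + 2) ^ 26 + 1 ∧
      HittingSets.IsHittingSetFor (↑H : Set (Fin n → K))
        (DDS2021.border {g : MvPolynomial (Fin n) (RatFunc K) |
          g.totalDegree ≤ d ∧ complexity g ≤ s}) := by
  obtain ⟨H, hcard, hH⟩ := exists_hittingSet_border_smallCircuits (K := K) n s d
  refine ⟨H, hcard, fun f hf hf0 => ?_⟩
  obtain ⟨g, ⟨hgd, hgs⟩, hfg⟩ := hf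
  exact hH f hf0 ⟨g, hgd, hgs, hfg⟩

/-! ## The `ε`-closure of a parametrised class over `K((ε))` (Andrews–Forbes' `𝒞̄`, `borderClass`)
lies in the Zariski closure of its `K`-members -/

section Generic

variable {n : ℕ} {ι : Type*} {J : Type*} {𝒢 : J → MvPolynomial (Fin n) (MvPolynomial ι K)}

/-- Evaluating a polynomial with coefficients in `K` at two `K((ε))`-points that are `O(1)` and
agree modulo `ε` gives `O(1)` values that agree modulo `ε` (the private lemma of the same name in
`BorderComplexityZariski.lean`, re-proved). [folklore] -/
private theorem isOrdGE_aeval_sub_aeval {τ : Type*} (P : MvPolynomial τ K)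
    {x y : τ → LaurentSeries K} (hx : ∀ t, IsOrdGE 0 (x t)) (hy : ∀ t, IsOrdGE 0 (y t))
    (hxy : ∀ t, IsOrdGE 1 (x t - y t)) :
    IsOrdGE 0 (aeval x P) ∧ IsOrdGE 0 (aeval y P) ∧ IsOrdGE 1 (aeval x P - aeval y P) := by
  induction P using MvPolynomial.induction_on with
  | C a =>
    simp only [algHom_C, algebraMap_laurentSeries_apply, sub_self]
    exact ⟨IsOrdGE.C a, IsOrdGE.C a, IsOrdGE.zero 1⟩
  | add p q hp hq =>
    obtain ⟨hp0, hp1, hp2⟩ := hp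
    obtain ⟨hq0, hq1, hq2⟩ := hq
    refine ⟨?_, ?_, ?_⟩
    · rw [map_add]; exact hp0.add hq0
    · rw [map_add]; exact hp1.add hq1
    · have : aeval x (p + q) - aeval y (p + q) =
          (aeval x p - aeval y p) + (aeval x q - aeval y q) := by
        rw [map_add, map_add]; ring
      rw [this]; exact hp2.add hq2
  | mul_X p t hp =>
    obtain ⟨hp0, hp1, hp2⟩ := hp
    refine ⟨?_, ?_, ?_⟩
    · rw [map_mul, aeval_X]; simpa using hp0.mul (hx t)
    · rw [map_mul, aeval_X]; simpa using hp1.mul (hy t)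
    · have : aeval x (p * X t) - aeval y (p * X t) =
          (aeval x p - aeval y p) * x t + aeval y p * (x t - y t) := by
        rw [map_mul, map_mul, aeval_X, aeval_X]; ring
      rw [this]
      have h1 := hp2.mul (hx t)
      have h2 := hp1.mul (hxy t)
      simp only [add_zero, zero_add] at h1 h2
      exact h1.add h2

/-- **A polynomial identity among coefficients that holds for all `K`-members of a piece holds for
its members over every `K`-algebra** ("generic constants", Bürgisser 2004 §5.3 / BCS 1997 §4.1,
here for a parametrised class: the identity pulled back to the parameter ring `K[y]` vanishes at
every `K`-point, hence is `0`, `K` being infinite; `L` in the universe of `K`). [cite: Burgisser2004Factors, §5.3 (generic straight-line programs)] -/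
theorem aeval_coeff_member_eq_zero [Infinite K] {L : Type u} [CommRing L] [Algebra K L]
    {j : J} {P : MvPolynomial (Fin n →₀ ℕ) K}
    (hP : ∀ y ∈ coeffVec '' {g : MvPolynomial (Fin n) K | ∃ β : ι → K,
        g = MvPolynomial.map (aeval β : MvPolynomial ι K →ₐ[K] K).toRingHom (𝒢 j)},
      aeval y P = 0)
    (α : ι → L) :
    aeval (fun μ => coeff μ
      (MvPolynomial.map (aeval α : MvPolynomial ι K →ₐ[K] L).toRingHom (𝒢 j))) P = 0 := by
  -- pull the identity back to the parameter ring `K[y]`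
  set Pj : MvPolynomial ι K := aeval (fun μ => coeff μ (𝒢 j)) P with hPj
  have hnat : ∀ (B : Type u) [CommRing B] [Algebra K B] (θ : MvPolynomial ι K →ₐ[K] B),
      θ Pj = aeval (fun μ => coeff μ (MvPolynomial.map θ.toRingHom (𝒢 j))) P := by
    intro B _ _ θ
    have hfun : (fun μ => θ (coeff μ (𝒢 j))) =
        fun μ => coeff μ (MvPolynomial.map θ.toRingHom (𝒢 j)) := by
      funext μ
      rw [coeff_map]
      rfl
    rw [hPj, ← AlgHom.comp_apply, MvPolynomial.comp_aeval, ← hfun]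
  have hPj0 : Pj = 0 := by
    refine MvPolynomial.funext fun β => ?_
    rw [map_zero]
    change aeval β Pj = 0
    rw [hnat K (aeval β)]
    exact hP _ ⟨_, ⟨β, rfl⟩, rfl⟩
  have h := hnat L (aeval α)
  rw [hPj0, map_zero] at h
  exact h.symm

/-- **The `ε`-closure of a parametrised class lies in the Zariski closure of its `K`-members**
(Bürgisser 2004, Thm. 2.2, easy inclusion "if `L̲(f) ≤ r` then `f` lies in the closure (Zariski or
Euclidean) of `{L ≤ r}`", for classes given by generic members; Andrews–Forbes 2022, Def. 2.1 / §2.1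
for the closure `𝒞̄ = borderClass`): if `h = 𝒢_j(α)`, `α ∈ K((ε))^ι`, and `h = f + O(ε)`
coefficientwise, then every polynomial relation among coefficients valid on the `K`-members holds
at `coeff h` (`aeval_coeff_member_eq_zero`), and `P(coeff h) = P(coeff f) + O(ε)` because `P`
has coefficients in `K`, so `P(coeff f) = 0`. `K` infinite.
[cite: Burgisser2004Factors, Thm. 2.2 (easy inclusion); AndrewsForbes2022, Def. 2.1 and §2.1 (closure of a class)] -/
theorem coeffVec_mem_zariskiClosure_of_mem_borderClass [Infinite K] {f : MvPolynomial (Fin n) K}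
    (hf : f ∈ borderClass K {g | IsMember 𝒢 (LaurentSeries K) g}) :
    coeffVec f ∈ zariskiClosure (coeffVec '' {g | IsMember 𝒢 K g}) := by
  obtain ⟨h, ⟨j, α, hhα⟩, hh⟩ := hf
  rw [mem_zariskiClosure_iff]
  intro P hP
  -- the relation holds at `coeff h`
  have hPh : aeval (coeffVec h) P = 0 := by
    rw [hhα]
    refine aeval_coeff_member_eq_zero (fun y hy => hP y ?_) α
    obtain ⟨g, ⟨β, hg⟩, rfl⟩ := hy
    exact ⟨g, ⟨j, β, hg⟩, rfl⟩
  -- `coeff h = coeff f + O(ε)` coefficientwise, and both are `O(1)`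
  have hx : ∀ d, IsOrdGE 0 (coeffVec h d) := fun d => by
    have : h = (h - MvPolynomial.map (algebraMap K (LaurentSeries K)) f) +
        MvPolynomial.map (algebraMap K (LaurentSeries K)) f := by ring
    rw [coeffVec_apply, this, coeff_add]
    exact ((hh d).mono zero_le_one).add (PolyOrdGE.map_algebraMap f d)
  have hy : ∀ d, IsOrdGE 0 (coeff d (MvPolynomial.map (algebraMap K (LaurentSeries K)) f)) :=
    fun d => PolyOrdGE.map_algebraMap f d
  have hxy : ∀ d, IsOrdGE 1
      (coeffVec h d - coeff d (MvPolynomial.map (algebraMap K (LaurentSeries K)) f)) :=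
    fun d => by rw [coeffVec_apply, ← coeff_sub]; exact hh d
  obtain ⟨-, -, hdiff⟩ := isOrdGE_aeval_sub_aeval P hx hy hxy
  rw [hPh, zero_sub] at hdiff
  -- `P(coeff (map f)) = algebraMap (P(coeff f))`, a constant, so it vanishes
  have hconst : aeval (fun d => coeff d (MvPolynomial.map (algebraMap K (LaurentSeries K)) f)) P =
      algebraMap K (LaurentSeries K) (aeval (coeffVec f) P) := by
    have hfun : (fun d => coeff d (MvPolynomial.map (algebraMap K (LaurentSeries K)) f)) =
        fun d => (Algebra.ofId K (LaurentSeries K)) (coeffVec f d) := by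
      funext d
      rw [coeff_map, coeffVec_apply]
      rfl
    rw [hfun, ← MvPolynomial.comp_aeval, AlgHom.comp_apply]
    rfl
  rw [hconst, algebraMap_laurentSeries_apply] at hdiff
  have h1 := hdiff.neg
  rw [neg_neg] at h1
  have h0 := h1 0 zero_lt_one
  rwa [HahnSeries.C_apply, HahnSeries.coeff_single_same] at h0

variable (𝒢) in
/-- **Heintz–Schnorr 1980, Thm. 4.4 (existence half) for Andrews–Forbes' closure `𝒞̄` of a
parametrised class.** Over an infinite field `K`, a class with generic members
`𝒢_j ∈ K[y_1, …, y_r][x]` has a set of at most `r + 1` points hitting every non-zero `f ∈ K[x]`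
of `borderClass K 𝒞_{K((ε))}` — i.e. with `h = f + O(ε)` coefficientwise for some member `h` over
the Laurent series field `K((ε))` (Andrews–Forbes 2022, Def. 2.1 / §2.1). Via
`coeffVec_mem_zariskiClosure_of_mem_borderClass` and `exists_hittingSet_zariskiClosure`.
[cite: HeintzSchnorr1980, Thm. 4.4; AndrewsForbes2022, §2.1 (closure of a class)] -/
theorem exists_hittingSet_borderClass [Fintype J] [Fintype ι] [Infinite K] :
    ∃ H : Finset (Fin n → K), H.card ≤ Fintype.card ι + 1 ∧
      HittingSets.IsHittingSetFor (↑H : Set (Fin n → K))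
        (borderClass K {g | IsMember 𝒢 (LaurentSeries K) g}) := by
  obtain ⟨H, hcard, hH⟩ := exists_hittingSet_zariskiClosure 𝒢
  exact ⟨H, hcard, fun f hf hf0 => hH f hf0 (coeffVec_mem_zariskiClosure_of_mem_borderClass hf)⟩

end Generic

/-! ## The Zariski closure `W(n,s,d)` (Heintz–Schnorr's own closure) -/

/-- **Heintz–Schnorr 1980, Thm. 4.4 (existence half), for `W(n,s,d)` verbatim.** Over an infinite
field `K`, for all `n, s, d` there is `H ⊆ K^n` with `|H| ≤ 9376(n+d+s+2)^26 + 1` such that every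
non-zero `f ∈ K[x_1, …, x_n]` whose coefficient vector lies in the ZARISKI CLOSURE of the
coefficient vectors of the polynomials of total degree `≤ d` and complexity `≤ s`
(`W(n,s,d) = zariskiClosure (coeffVec '' {g | deg g ≤ d ∧ L(g) ≤ s})`) satisfies `f(x) ≠ 0` for
some `x ∈ H`. Printed: "Theorem 4.4: … there exist hitting sets `H ⊂ [u]^n`, `u = 2s(d+1)²`,
`#H = 6(s+1+n)²` for `W(n,s,d)`" (nonscalar cost, char. `0`); here the tree's fan-in-two
`complexity` (constants free), `p + 1` points for the `p`-label universal circuit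
(`exists_generic_smallCircuits`, whose `K`-specialisations contain the class), coordinates
unbounded. [cite: HeintzSchnorr1980, Thm. 4.4] -/
theorem exists_hittingSet_zariskiClosure_smallCircuits [Infinite K] (n s d : ℕ) :
    ∃ H : Finset (Fin n → K), H.card ≤ 9376 * (n + d + s + 2) ^ 26 + 1 ∧
      ∀ f : MvPolynomial (Fin n) K, f ≠ 0 →
        coeffVec f ∈ zariskiClosure (coeffVec ''
          {g : MvPolynomial (Fin n) K | g.totalDegree ≤ d ∧ complexity g ≤ s}) →
        ∃ x ∈ H, eval x f ≠ 0 := by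
  obtain ⟨p, 𝒢, hp, hmem⟩ := exists_generic_smallCircuits (K := K) n s d
  obtain ⟨H, hcard, hH⟩ := exists_hittingSet_zariskiClosure 𝒢
  refine ⟨H, ?_, fun f hf0 hf => hH f hf0 (zariskiClosure_mono (Set.image_mono ?_) hf)⟩
  · rw [Fintype.card_fin] at hcard
    omega
  · rintro g ⟨hgd, hgs⟩
    exact hmem K g hgd hgs

/-- The same as a hitting set (`HittingSets.IsHittingSetFor`) for the class of polynomials with
coefficient vector in `W(n,s,d)`. [cite: HeintzSchnorr1980, Thm. 4.4] -/
theorem isHittingSetFor_zariskiClosure_smallCircuits [Infinite K] (n s d : ℕ) :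
    ∃ H : Finset (Fin n → K), H.card ≤ 9376 * (n + d + s + 2) ^ 26 + 1 ∧
      HittingSets.IsHittingSetFor (↑H : Set (Fin n → K))
        {f : MvPolynomial (Fin n) K | coeffVec f ∈ zariskiClosure (coeffVec ''
          {g : MvPolynomial (Fin n) K | g.totalDegree ≤ d ∧ complexity g ≤ s})} := by
  obtain ⟨H, hcard, hH⟩ := exists_hittingSet_zariskiClosure_smallCircuits (K := K) n s d
  exact ⟨H, hcard, fun f hf hf0 => hH f hf0 hf⟩

/-- **Heintz–Schnorr for the `\overline{VP}`-slice in Andrews–Forbes' currency**: over an infinite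
field `K`, for all `n, s, d` there is `H ⊆ K^n`, `|H| ≤ 9376(n+d+s+2)^26 + 1`, which is a hitting
set for `borderClass K {g ∈ K((ε))[x] | deg g ≤ d, complexity g ≤ s}` — every non-zero `f ∈ K[x]`
with `g = f + O(ε)` coefficientwise for such a `g` over the Laurent series field (this contains the
`K(ε)`-border of `isHittingSetFor_border_smallCircuits`).
[cite: HeintzSchnorr1980, Thm. 4.4; AndrewsForbes2022, Def. 2.1] -/
theorem isHittingSetFor_borderClass_smallCircuits [Infinite K] (n s d : ℕ) :
    ∃ H : Finset (Fin n → K), H.card ≤ 9376 * (n + d + s + 2) ^ 26 + 1 ∧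
      HittingSets.IsHittingSetFor (↑H : Set (Fin n → K))
        (borderClass K {g : MvPolynomial (Fin n) (LaurentSeries K) |
          g.totalDegree ≤ d ∧ complexity g ≤ s}) := by
  obtain ⟨p, 𝒢, hp, hmem⟩ := exists_generic_smallCircuits (K := K) n s d
  obtain ⟨H, hcard, hH⟩ := exists_hittingSet_borderClass 𝒢
  refine ⟨H, ?_, fun f hf hf0 => hH f ?_ hf0⟩
  · rw [Fintype.card_fin] at hcard
    omega
  · obtain ⟨h, ⟨hhd, hhs⟩, hh⟩ := hf
    exact ⟨h, hmem (LaurentSeries K) h hhd hhs, hh⟩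

/-! ## The closure complexities `\underline{L}` (BLMW, Zariski) and `L̲_ε` (Bürgisser, `ε`) -/

/-- **Truncation bridge over any field** (Bürgisser 2004 Thm. 2.2 / §2 "limit of the Zariski
topologies on `{deg ≤ d}`"; the `ℂ`-instance with `r = \underline{L}(F)` is
`coeffVec_mem_zariskiClosure_truncated`): if `deg F ≤ d` and `coeff F` lies in the Zariski closure
of the coefficient vectors of `{g | L(g) ≤ r}` (any degrees), then it lies in the closure of those
of `{g | deg g ≤ d, L(g) ≤ (d+2)² r + (d+1)}` — truncation `P ↦ Σ_{i ≤ d} P^{(i)}` is row-finite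
(`rowFinite_comp_truncation`), hence Zariski-continuous (`coeffVec_mem_zariskiClosure_of_rowFinite`),
fixes `F`, and costs `(d+2)² L(P) + (d+1)` (BCS 1997 Lemma (21.25),
`complexity_sum_homogeneousComponent_le`).
[cite: Burgisser2004Factors, Thm. 2.2; BurgisserClausenShokrollahi1997, Lemma (21.25)] -/
theorem coeffVec_mem_zariskiClosure_truncated_of_mem {σ : Type*} [Finite σ]
    {F : MvPolynomial σ K} {d r : ℕ} (hF : F.totalDegree ≤ d)
    (h : coeffVec F ∈ zariskiClosure (coeffVec '' {g : MvPolynomial σ K | complexity g ≤ r})) :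
    coeffVec F ∈ zariskiClosure (coeffVec ''
      {g : MvPolynomial σ K | g.totalDegree ≤ d ∧ complexity g ≤ (d + 2) ^ 2 * r + (d + 1)}) := by
  have h' := coeffVec_mem_zariskiClosure_of_rowFinite
    (LinearMap.id ∘ₗ ∑ i ∈ Finset.range (d + 1),
      (homogeneousComponent i : MvPolynomial σ K →ₗ[K] MvPolynomial σ K))
    (rowFinite_comp_truncation LinearMap.id d)
    (S := {g : MvPolynomial σ K | complexity g ≤ r})
    (T := {g : MvPolynomial σ K | g.totalDegree ≤ d ∧ complexity g ≤ (d + 2) ^ 2 * r + (d + 1)})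
    (fun g hg => ?_) h
  · rw [LinearMap.comp_apply, LinearMap.sum_apply, LinearMap.id_apply,
      DepthReduction.sum_homogeneousComponent_of_le hF] at h'
    exact h'
  · rw [LinearMap.comp_apply, LinearMap.sum_apply, LinearMap.id_apply]
    refine ⟨?_, (complexity_sum_homogeneousComponent_le g d).trans
      (Nat.add_le_add_right (Nat.mul_le_mul_left _ hg) _)⟩
    refine totalDegree_finsetSum_le fun i hi => ?_
    have hi' := Finset.mem_range.mp hi
    exact (homogeneousComponent_isHomogeneous i g).totalDegree_le.trans (by omega)

/-- **Heintz–Schnorr for BLMW's `\underline{L}` (`approxComplexity`, BLMW 2011 Def. 9.3.1: "`f` is in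
the closure of `{g ∈ A | L(g) ≤ r}`", Zariski closure in coefficient space, over `ℂ`).** For all
`n, s, d` there is `H ⊆ ℂ^n`, `|H| ≤ 9376(n+d+s'+2)^26 + 1` with `s' = (d+2)²s + (d+1)`, such that
every non-zero `f ∈ ℂ[x_1, …, x_n]` with `deg f ≤ d` and `\underline{L}(f) ≤ s` has `f(x) ≠ 0` for
some `x ∈ H` (truncate the approximants to degree `≤ d`, `coeffVec_mem_zariskiClosure_truncated_of_mem`,
then `W(n,s',d)`). These are the non-explicit hitting sets for `\overline{VP}`-slices whose existence
the PIT literature credits to [HS80]. [cite: HeintzSchnorr1980, Thm. 4.4; BurgisserEtAl2011, Def. 9.3.1] -/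
theorem exists_hittingSet_approxComplexity_le (n s d : ℕ) :
    ∃ H : Finset (Fin n → ℂ), H.card ≤ 9376 * (n + d + ((d + 2) ^ 2 * s + (d + 1)) + 2) ^ 26 + 1 ∧
      ∀ f : MvPolynomial (Fin n) ℂ, f ≠ 0 → f.totalDegree ≤ d → approxComplexity f ≤ s →
        ∃ x ∈ H, eval x f ≠ 0 := by
  obtain ⟨H, hcard, hH⟩ :=
    exists_hittingSet_zariskiClosure_smallCircuits (K := ℂ) n ((d + 2) ^ 2 * s + (d + 1)) d
  refine ⟨H, hcard, fun f hf0 hfd hfs =>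
    hH f hf0 (coeffVec_mem_zariskiClosure_truncated_of_mem hfd ?_)⟩
  exact zariskiClosure_mono
    (Set.image_mono fun g hg => show complexity g ≤ s from le_trans hg hfs)
    (coeffVec_mem_zariskiClosure_approxComplexity f)

/-- **Heintz–Schnorr for the `ε`-rendering `L̲_ε` (`borderComplexity`, Bürgisser 2004 Def. 2.1 /
CKRST v4 Def. 1.12: a size-`s` circuit over `K((ε))` computes `f + O(ε)`), any infinite field.**
For all `n, s, d` there is `H ⊆ K^n`, `|H| ≤ 9376(n+d+s'+2)^26 + 1` with `s' = (d+2)²s + (d+1)`,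
hitting every non-zero `f ∈ K[x_1, …, x_n]` with `deg f ≤ d` and `borderComplexity f ≤ s`: by the
easy inclusion of Bürgisser 2004 Thm. 2.2 (`coeffVec_mem_zariskiClosure_of_borderComplexity_le`)
such an `f` lies in the Zariski closure of `{g | L(g) ≤ s}`, then truncation and `W(n,s',d)`.
[cite: HeintzSchnorr1980, Thm. 4.4; Burgisser2004Factors, Def. 2.1 and Thm. 2.2] -/
theorem exists_hittingSet_borderComplexity_le [Infinite K] (n s d : ℕ) :
    ∃ H : Finset (Fin n → K), H.card ≤ 9376 * (n + d + ((d + 2) ^ 2 * s + (d + 1)) + 2) ^ 26 + 1 ∧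
      ∀ f : MvPolynomial (Fin n) K, f ≠ 0 → f.totalDegree ≤ d → borderComplexity f ≤ s →
        ∃ x ∈ H, eval x f ≠ 0 := by
  obtain ⟨H, hcard, hH⟩ :=
    exists_hittingSet_zariskiClosure_smallCircuits (K := K) n ((d + 2) ^ 2 * s + (d + 1)) d
  exact ⟨H, hcard, fun f hf0 hfd hfs => hH f hf0
    (coeffVec_mem_zariskiClosure_truncated_of_mem hfd
      (coeffVec_mem_zariskiClosure_of_borderComplexity_le f hfs))⟩

end BorderHittingSets

end Literature.Computability.AlgebraicComplexity

end
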